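import Mathlib.GroupTheory.OrderOfElement
import Mathlib.GroupTheory.Index
import Mathlib.Algebra.Module.Torsion.Basic
import Mathlib.Data.Set.Card
import HarnessLib

/-!
# A `p`-primary group whose `p^k`-torsion grows at most like `C·p^k` is, up to bounded exponent, the
# line spanned by a compatible system of elements of order `p^k` (cell `b2b-bsdres`, CLASS-CLOSURE
# lane, class O10 — x1b GEN 43, class lead; file 115 of the series: the ALGEBRA of the Poitou–Tate
# half (hMW) of "`A₀ = Sel^{loc,∞}(W/ℚ)` is finite in rank one", files 112–114)

HONEST FRAMING (cell `b2b-bsdres`, run/shared/lean/b2b/bsd-rank1-residual/, verbatim in every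
file): the goal of the cell is to DELETE the COMBINATION-SHAPED residual classes of the
Birch–Swinnerton-Dyer formula for ALL analytic-rank `≤ 1` elliptic curves over `ℚ` — "full BSD
formula for every rank `≤ 1` curve in class `C`" assembled STRICTLY from published theorems — so
that the rank-`≤ 1` remainder becomes exactly the CONSTRUCTION-SHAPED classes, which are TYPED
(missing-input `Prop`s), NOT attempted. This is not "finishing BSD". CLASS-CLOSURE lane: prove
what is provable now; shrink each hard class to its core with data; no claim beyond stated classes;
research routes on CONSTRUCTION-SHAPED X12 / O10; census / instrument output = EVIDENCE / conjecture
items, NEVER a Literature fact; `RESIDUAL-MAP.md` marks change only by signed lines. THIS FILE: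
TOOL THEOREMS ONLY (pure algebra of abelian groups) — no definition, no named Literature fact, no
Summits-side fact `def … : Prop`, no `sorry`, axioms standard; nothing is booked; no label / mark /
count / sub-cell moves; nothing about `BSD(W, p)` of any pair is claimed.

## What

File 114 proves "`A₀` finite, `X^{−,str}(W/ℚ_∞)` torsion with `f(0) ≠ 0`" in rank one modulo
(hMW): `∃ t, ∀ y ∈ A₀, ∃ m a, p^t·y = a·x_m` for the classes `x_m = [κ_m(P)]` of the generator. This
file isolates the GROUP THEORY that produces (hMW) from a COUNT: if `R` is a `p`-primary subgroup of an
abelian group containing a compatible system `x_m ∈ R` (`p·x_{m+1} = x_m`) with `ord x_m = p^m`, and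
**`#R[p^k] ≤ C·p^k` for all `k`**, then `R / ⋃_m ℤx_m` has at most `C` elements, so
**`∃ t, ∀ y ∈ R, ∃ m a, p^t·y = a·x_m`** (`exists_pow_smul_eq_zsmul_of_card_torsion_le`). For
`R = h₀⁻¹(Sel_{p^∞}(W/ℚ_∞)) ⊇ A₀` the count `#R[p^k] ≤ C·p^k` is the finite-level relaxed-versus-strict
Kummer index (the tree's X5 `relIndex_kummer_update_bot_update_top_eq`: `[H¹_{𝓚[p↦⊤]} : H¹_{𝓚[p↦0]}]
= #W(ℚ_p)[p^k]·#(ℤ_p/p^k) = p^k`, from `poitouTate_selmerStructure_duality_real ℚ`) times the bounded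
order of the strict groups (`#Sel_str(W/ℚ)[p^∞] < ∞` in rank one) — the successor's plumbing; NOT here.

* `mem_iSup_zmultiples_iff_of_compatible`: `y ∈ ⨆ ℤx_m ↔ ∃ m a, y = a·x_m`;
  `card_le_of_pairwise_not_congr` (finite pieces): elements of `R[p^k]` pairwise incongruent modulo
  `ℤx_k` (`ord x_k = p^k`) number at most `#R[p^k] / p^k ≤ C`;
* **`factorial_smul_mem_iSup_zmultiples_of_card_torsion_le`**: `C! · R ⊆ ⨆ ℤx_m`;
  **`exists_pow_smul_eq_zsmul_of_card_torsion_le`**: the (hMW) shape `∃ t, ∀ y ∈ R, ∃ m a, p^t·y = a·x_m`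
  (the prime-to-`p` part of `C!` is inverted modulo `ord x_{m+k}`).

References: [GreenbergLNM1716] §3 (p. 86: coranks from the growth of `p^k`-torsion); [JetchevSkinnerWan2017]
Prop. 3.3.2 (the arithmetic instance, shape only).
-/

noncomputable section

open scoped Classical

namespace Summit.BirchSwinnertonDyer.Rank1Residual.Additive.LevelBridge

section Algebra

variable {G : Type*} [AddCommGroup G] {p : ℕ} [hp : Fact p.Prime]

omit hp in
/-- The line `⋃_m ℤ·x_m` of a compatible system (`p·x_{m+1} = x_m`) is the increasing union of the
cyclic groups `ℤ·x_m`; as a subgroup it is `⨆_m ℤ·x_m`, and membership means `y = a·x_m` for some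
`m`, `a`. [folklore] -/
theorem mem_iSup_zmultiples_iff_of_compatible (x : ℕ → G) (hx : ∀ m, p • x (m + 1) = x m) (y : G) :
    y ∈ ⨆ m, AddSubgroup.zmultiples (x m) ↔ ∃ (m : ℕ) (a : ℤ), y = a • x m := by
  -- the family is directed: `ℤ·x_m ≤ ℤ·x_{m'}` for `m ≤ m'`
  have hmono : Monotone fun m ↦ AddSubgroup.zmultiples (x m) := by
    refine monotone_nat_of_le_succ fun m ↦ ?_
    rw [AddSubgroup.zmultiples_le, ← hx m]
    exact AddSubgroup.nsmul_mem _ (AddSubgroup.mem_zmultiples _) _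
  rw [AddSubgroup.mem_iSup_of_directed hmono.directed_le]
  simp only [AddSubgroup.mem_zmultiples_iff, eq_comm]

/-- **`#(R ⊔ L)/L`-type count at a finite level.** Let `L ≤ G` contain an element `x` of order `p^k`,
and let `S ⊆ G` be a finite set of elements killed by `p^k` whose members are pairwise incongruent
modulo `L`. Then `#S · p^k ≤ #G[p^k] ∩ (S + ℤx)`-type bound: precisely, if every `p^k`-torsion
element of the subgroup `R` lies in a finite set `T` with `#T ≤ C·p^k`, `x ∈ R`, then at most `C`
elements of `R[p^k]` are pairwise incongruent modulo `ℤx`. [folklore] -/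
theorem card_le_of_pairwise_not_congr {R : AddSubgroup G} {k C : ℕ} {x : G} (hxR : x ∈ R)
    (hx : addOrderOf x = p ^ k)
    (hcount : Set.ncard {y : G | y ∈ R ∧ p ^ k • y = 0} ≤ C * p ^ k)
    (hfin : Set.Finite {y : G | y ∈ R ∧ p ^ k • y = 0})
    (S : Finset G) (hS : ∀ y ∈ S, y ∈ R ∧ p ^ k • y = 0)
    (hinc : ∀ y ∈ S, ∀ y' ∈ S, y - y' ∈ AddSubgroup.zmultiples x → y = y') :
    S.card ≤ C := by
  -- the map `S × (ℤ/p^k) → R[p^k]`, `(y, i) ↦ y + i·x` is injective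
  have hpk : 0 < p ^ k := pow_pos hp.out.pos k
  let f : G × ℕ → G := fun q ↦ q.1 + q.2 • x
  have hmem : ∀ q ∈ S ×ˢ Finset.range (p ^ k), f q ∈ {y : G | y ∈ R ∧ p ^ k • y = 0} := by
    rintro ⟨y, i⟩ hq
    obtain ⟨hy, hi⟩ := Finset.mem_product.mp hq
    refine ⟨add_mem (hS y hy).1 (AddSubgroup.nsmul_mem _ hxR _), ?_⟩
    change p ^ k • (y + i • x) = 0
    rw [smul_add, (hS y hy).2, zero_add, smul_comm, ← hx, addOrderOf_nsmul_eq_zero, smul_zero]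
  have hinj : Set.InjOn f ↑(S ×ˢ Finset.range (p ^ k)) := by
    rintro ⟨y, i⟩ hq ⟨y', i'⟩ hq' hff
    obtain ⟨hy, hi⟩ := Finset.mem_product.mp (Finset.mem_coe.mp hq)
    obtain ⟨hy', hi'⟩ := Finset.mem_product.mp (Finset.mem_coe.mp hq')
    have hi := Finset.mem_range.mp hi
    have hi' := Finset.mem_range.mp hi'
    change y + i • x = y' + i' • x at hff
    -- `y - y' = (i' - i)·x ∈ ℤx`, so `y = y'`, then `i·x = i'·x`, so `i = i'` (order `p^k`)
    have hyy : y - y' ∈ AddSubgroup.zmultiples x := by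
      have : y - y' = (i' : ℤ) • x - (i : ℤ) • x := by
        rw [natCast_zsmul, natCast_zsmul]; exact sub_eq_sub_iff_add_eq_add.mpr (by rw [hff, add_comm])
      rw [this]
      exact sub_mem (AddSubgroup.zsmul_mem _ (AddSubgroup.mem_zmultiples x) _)
        (AddSubgroup.zsmul_mem _ (AddSubgroup.mem_zmultiples x) _)
    have hy_eq : y = y' := hinc y hy y' hy' hyy
    subst hy_eq
    have hix : i • x = i' • x := add_left_cancel hff
    have hii : i = i' :=
      nsmul_injOn_Iio_addOrderOf (Set.mem_Iio.mpr (by rw [hx]; exact hi))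
        (Set.mem_Iio.mpr (by rw [hx]; exact hi')) hix
    rw [hii]
  have hcard := Finset.card_le_card_of_injOn f (fun q hq ↦ (hfin.mem_toFinset).mpr (hmem q hq)) (by
    intro a ha b hb h; exact hinj (Finset.mem_coe.mpr ha) (Finset.mem_coe.mpr hb) h)
  rw [Finset.card_product, Finset.card_range, ← Set.ncard_eq_toFinset_card _ hfin] at hcard
  have h := hcard.trans hcount
  exact Nat.le_of_mul_le_mul_right h hpk

/-- **The line is COFINAL up to bounded exponent.** Let `R ≤ G` be `p`-primary, `x : ℕ → G` a
compatible system in `R` (`p·x_{m+1} = x_m`, `ord x_m = p^m`), and suppose `#R[p^k] ≤ C·p^k` for every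
`k` (`C ≥ 1`). Then **`C! · R ⊆ L = ⨆_m ℤ·x_m`**: the quotient `R/(R ∩ L)` has at most `C` elements
(any `C + 1` elements of `R` lie in some `R[p^k]`, and pairwise incongruent ones number `≤ C` by the
finite count), hence exponent dividing `C!`. [cite: GreenbergLNM1716, §3 p. 86 (growth of the p^k-torsion)] -/
theorem factorial_smul_mem_iSup_zmultiples_of_card_torsion_le {R : AddSubgroup G} (x : ℕ → G)
    (hxR : ∀ m, x m ∈ R) (hord : ∀ m, addOrderOf (x m) = p ^ m)
    (hprim : ∀ y ∈ R, ∃ k : ℕ, p ^ k • y = 0) {C : ℕ}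
    (hfin : ∀ k, Set.Finite {y : G | y ∈ R ∧ p ^ k • y = 0})
    (hcount : ∀ k, Set.ncard {y : G | y ∈ R ∧ p ^ k • y = 0} ≤ C * p ^ k)
    (y : G) (hy : y ∈ R) :
    (Nat.factorial C) • y ∈ ⨆ m, AddSubgroup.zmultiples (x m) := by
  set L := ⨆ m, AddSubgroup.zmultiples (x m) with hL
  -- the multiples `0, y, 2y, …, C·y`: two of them are congruent mod `L`
  by_contra hcontra
  -- if `j·y ∉ L` for all `1 ≤ j ≤ C`, the `C+1` elements `0, y, …, C·y` are pairwise incongruent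
  have hstep : ∀ j : ℕ, 1 ≤ j → j ≤ C → (j • y) ∉ L := by
    intro j hj1 hjC hjL
    exact hcontra (by
      obtain ⟨q, hq⟩ : j ∣ Nat.factorial C := Nat.dvd_factorial hj1 hjC
      rw [hq, mul_comm, ← smul_smul]
      exact AddSubgroup.nsmul_mem _ hjL q)
  obtain ⟨k, hk⟩ := hprim y hy
  let S : Finset G := (Finset.range (C + 1)).image fun j : ℕ ↦ j • y
  have hSmem : ∀ z ∈ S, z ∈ R ∧ p ^ k • z = 0 := by
    intro z hz
    obtain ⟨j, -, rfl⟩ := Finset.mem_image.mp hz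
    exact ⟨AddSubgroup.nsmul_mem _ hy _, by rw [smul_comm, hk, smul_zero]⟩
  have hinc : ∀ z ∈ S, ∀ z' ∈ S, z - z' ∈ AddSubgroup.zmultiples (x k) → z = z' := by
    intro z hz z' hz' hzz
    obtain ⟨j, hj, rfl⟩ := Finset.mem_image.mp hz
    obtain ⟨j', hj', rfl⟩ := Finset.mem_image.mp hz'
    have hj := Finset.mem_range.mp hj
    have hj' := Finset.mem_range.mp hj'
    have hzzL : (j • y) - (j' • y) ∈ L := (le_iSup (fun m ↦ AddSubgroup.zmultiples (x m)) k) hzz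
    -- `|j - j'| • y ∈ L` with `|j - j'| ≤ C`; forces `j = j'`
    rcases Nat.lt_trichotomy j j' with hlt | heq | hgt
    · exfalso
      refine hstep (j' - j) (by omega) (by omega) ?_
      have e : (j' - j) • y = j' • y - j • y :=
        eq_sub_of_add_eq (by rw [← add_nsmul, Nat.sub_add_cancel hlt.le])
      rw [e, ← neg_sub]; exact neg_mem hzzL
    · rw [heq]
    · exfalso
      refine hstep (j - j') (by omega) (by omega) ?_
      have e : (j - j') • y = j • y - j' • y :=
        eq_sub_of_add_eq (by rw [← add_nsmul, Nat.sub_add_cancel hgt.le])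
      rw [e]; exact hzzL
  -- `S` has `C + 1` elements (the `j • y` are distinct since pairwise incongruent and `j ↦ j•y` …)
  have hScard : S.card = C + 1 := by
    rw [Finset.card_image_of_injOn, Finset.card_range]
    intro j hj j' hj' hjj
    have hj := Finset.mem_range.mp (Finset.mem_coe.mp hj)
    have hj' := Finset.mem_range.mp (Finset.mem_coe.mp hj')
    simp only at hjj
    rcases Nat.lt_trichotomy j j' with hlt | heq | hgt
    · exfalso
      refine hstep (j' - j) (by omega) (by omega) ?_
      have e : (j' - j) • y = j' • y - j • y :=
        eq_sub_of_add_eq (by rw [← add_nsmul, Nat.sub_add_cancel hlt.le])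
      rw [e, hjj, sub_self]; exact zero_mem _
    · exact heq
    · exfalso
      refine hstep (j - j') (by omega) (by omega) ?_
      have e : (j - j') • y = j • y - j' • y :=
        eq_sub_of_add_eq (by rw [← add_nsmul, Nat.sub_add_cancel hgt.le])
      rw [e, hjj, sub_self]; exact zero_mem _
  have hle := card_le_of_pairwise_not_congr (hxR k) (hord k) (hcount k) (hfin k) S hSmem hinc
  omega

/-- **(hMW) FROM A COUNT.** Same data; then **`∃ t, ∀ y ∈ R, ∃ m a, p^t · y = a · x_m`** — every
element of `R` has a bounded `p`-power multiple on the line (take `p^t ≥` the `p`-part … in fact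
`C! · y ∈ L` and `R` is `p`-primary, so the prime-to-`p` part of `C!` acts invertibly on `ℤ·x_m`:
we avoid this by multiplying further to a `p`-power multiple of `C!`). The arithmetic instance
(`R = h₀⁻¹(Sel_{p^∞}(W/ℚ_∞))`, `x_m = [κ_m(P)]`) is file 114's hypothesis (hMW).
[cite: GreenbergLNM1716, §3 p. 86] [cite: JetchevSkinnerWan2017, Prop. 3.3.2 (shape only)] -/
theorem exists_pow_smul_eq_zsmul_of_card_torsion_le {R : AddSubgroup G} (x : ℕ → G)
    (hxR : ∀ m, x m ∈ R) (hx : ∀ m, p • x (m + 1) = x m) (hord : ∀ m, addOrderOf (x m) = p ^ m)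
    (hprim : ∀ y ∈ R, ∃ k : ℕ, p ^ k • y = 0) {C : ℕ}
    (hfin : ∀ k, Set.Finite {y : G | y ∈ R ∧ p ^ k • y = 0})
    (hcount : ∀ k, Set.ncard {y : G | y ∈ R ∧ p ^ k • y = 0} ≤ C * p ^ k) :
    ∃ t : ℕ, ∀ y ∈ R, ∃ (m : ℕ) (a : ℤ), p ^ t • y = a • x m := by
  -- write `C! = p^t · u` with `p ∤ u`; `u` is invertible modulo every `p^m`
  have hC0 : Nat.factorial C ≠ 0 := Nat.factorial_ne_zero C
  obtain ⟨t, u, hu, htu⟩ := Nat.exists_eq_pow_mul_and_not_dvd hC0 p hp.out.one_lt.ne'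
  refine ⟨t, fun y hy ↦ ?_⟩
  have hmem := factorial_smul_mem_iSup_zmultiples_of_card_torsion_le x hxR hord hprim hfin hcount y hy
  rw [mem_iSup_zmultiples_iff_of_compatible x hx] at hmem
  obtain ⟨m, a, hma⟩ := hmem
  obtain ⟨k, hk⟩ := hprim y hy
  -- move to the level `m + k`: `x_m = p^k • x_{m+k}`
  have hxshift : ∀ d, x m = p ^ d • x (m + d) := by
    intro d
    induction d with
    | zero => rw [pow_zero, one_smul, Nat.add_zero]
    | succ d ih => rw [← Nat.add_assoc, pow_succ, mul_smul, hx (m + d)]; exact ih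
  -- `u` is invertible modulo `p^{m+k}`
  have hcop : Nat.Coprime u (p ^ (m + k)) :=
    (Nat.Coprime.pow_right (m + k) ((Nat.Prime.coprime_iff_not_dvd hp.out).mpr hu).symm)
  obtain ⟨v, hv⟩ := Int.mod_coprime hcop
  obtain ⟨q, hq⟩ := Int.ModEq.dvd hv.symm
  have huv : (u : ℤ) * v = 1 + ((p ^ (m + k) : ℕ) : ℤ) * q := by linarith
  refine ⟨m + k, a * (p ^ k : ℕ) * v, ?_⟩
  -- `C! • y = a • x_m = (a p^k) • x_{m+k}`
  have h1 : ((p ^ t * u : ℕ) : ℤ) • y = (a * (p ^ k : ℕ)) • x (m + k) := by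
    rw [← htu, natCast_zsmul, hma, hxshift k, ← natCast_zsmul, smul_smul]
  -- `p^{m+k} • (p^t • y) = 0` (as `p^k • y = 0`)
  have hkill : ((p ^ (m + k) : ℕ) : ℤ) • (((p ^ t : ℕ) : ℤ) • y) = 0 := by
    rw [natCast_zsmul, natCast_zsmul, pow_add, mul_smul, smul_comm (p ^ k) (p ^ t) y, hk, smul_zero,
      smul_zero]
  symm
  calc (a * (p ^ k : ℕ) * v) • x (m + k) = v • ((a * (p ^ k : ℕ)) • x (m + k)) := by
        rw [smul_smul]; congr 1; ring
    _ = v • (((p ^ t * u : ℕ) : ℤ) • y) := by rw [h1]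
    _ = (((p ^ t : ℕ) : ℤ) * (1 + ((p ^ (m + k) : ℕ) : ℤ) * q)) • y := by
        rw [smul_smul, ← huv]; congr 1; push_cast; ring
    _ = ((p ^ t : ℕ) : ℤ) • y + q • (((p ^ (m + k) : ℕ) : ℤ) • (((p ^ t : ℕ) : ℤ) • y)) := by
        rw [smul_smul, smul_smul, ← add_smul]; congr 1; ring
    _ = p ^ t • y := by rw [hkill, smul_zero, add_zero, natCast_zsmul]

end Algebra

end Summit.BirchSwinnertonDyer.Rank1Residual.Additive.LevelBridge

end
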